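import Summits.KontsevichZagierPeriods.KontsevichZagierPeriods.Theorems.RootDecompWalshStrataEtypeSectors
import Summits.KontsevichZagierPeriods.KontsevichZagierPeriods.Theorems.RootDecompWalshStrataQuadricWalls04

/-!
# Root decomposition & Walsh strata — E-type assembly IV: the Lagrange frame and the wall-family atoms (gen 9, §43)

Route `RootDecompWalshStrata`, leaf `QuadricBakerDescent` (stmt-27597), residual R-E2 = the E-type ASSEMBLY
(NODE.md, decomp-kz-lens-4, GEN 9 MENU (1)).  `InBaker.of_Equad`: for a rational binary quadratic `D` with
POSITIVE discriminant of its quadratic part (E-type: `D = d₁₁X² + μY² + c` in the Lagrange frame, `μ/d₁₁ > 0`)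
the plane theorem `InBaker.of_Eplane` (§42) pulls back along the Lagrange map (det `1`, rule (2)).
`Quadric₃.sqrtDescentW_Etype`: the hypothesis `hW` of `quadricBakerDescent_of_sqrtDescentW` (§31) —
`[atom, γ√D] ∈ InBaker` on every atom of the wall family — HOLDS for every quadric of E-type whose two
`B`-walls `2Aℓᵢ + B` are good conic walls of `D` (`goodWalls`, §40: off the named thin strata).  Atoms are
empty, null, `√D ≡ 0`, or generic open cells whose frontier lies on the square's edges, on `D = 0`, on the
lines `2Aℓᵢ + B = 0`, `g = 0`, or on the conic walls `D = (2Aℓᵢ + B)²` (adaptedness, `Dxy_eq_sq_of_wall`).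
[KontsevichZagier2001 §1.2 rules (1)–(3); BCR1998 §2.2; this node]
-/

noncomputable section

open Set MeasureTheory MvPolynomial Literature.NumberTheory.Transcendental
open Literature.ModelTheory.ExponentialFields (IsSemialgebraic)

namespace Summit.KontsevichZagierPeriods.RootDecompWalshStrata.ConicDescent.BallCube

/-! #### 43.1 The Lagrange frame of an E-type binary quadratic -/

/-- The inverse of an invertible rational affine map is invertible. [folklore] -/
theorem AffMap.inv_det_ne (M : AffMap) (hdet : M.det ≠ 0) : M.inv.det ≠ 0 := by
  have h : M.inv.det * M.det = 1 := by
    rw [AffMap.det]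
    simp only [AffMap.inv]
    field_simp
    rw [AffMap.det]
    ring
  intro h0
  rw [h0, zero_mul] at h
  exact zero_ne_one h

namespace Quad2

variable (D : Quad2)

/-- The second weight of the E-type frame: `κ₁ = disc/(4d₁₁²) = μ/d₁₁`. -/
def eκ : ℚ := D.disc / (4 * D.d11 ^ 2)

/-- Auxiliary step `d11_ne_of_disc_pos`. [bookkeeping] -/
theorem d11_ne_of_disc_pos (hdisc : 0 < D.disc) : D.d11 ≠ 0 := fun h0 => by
  have h : D.disc = -D.d12 ^ 2 := by rw [Quad2.disc, h0]; ring
  nlinarith [sq_nonneg D.d12]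

/-- Auxiliary step `eκ_pos`. [bookkeeping] -/
theorem eκ_pos (hdisc : 0 < D.disc) : 0 < D.eκ := by
  have h11 := D.d11_ne_of_disc_pos hdisc
  rw [eκ]
  positivity

/-- Auxiliary step `d11_mul_eκ`. [bookkeeping] -/
theorem d11_mul_eκ (h11 : D.d11 ≠ 0) : D.d11 * D.eκ = D.μ := by
  rw [eκ, Quad2.μ]
  field_simp

/-- `D = d₁₁(X² + eκ·Y²) + cst` in the Lagrange frame `(X, Y) = lagM (x, y)`, for every `D` with `d₁₁ ≠ 0` and `disc ≠ 0`
(`eκ > 0`: definite = E-type; `eκ < 0`: indefinite = H-type). [Lagrange; this node] -/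
theorem eval_eq_erad (h11 : D.d11 ≠ 0) (hdisc : D.disc ≠ 0) (p : Fin 2 → ℝ) :
    D.eval (p 0) (p 1) = erad 1 D.eκ D.d11 D.cst (D.lagM.toFun p) := by
  have hμ : (D.d11 : ℝ) * (D.eκ : ℝ) = D.μ := by exact_mod_cast D.d11_mul_eκ h11
  have hp : (![p 0, p 1] : Fin 2 → ℝ) = p := by
    ext i; fin_cases i <;> rfl
  rw [D.eval_eq_normal h11 hdisc, hp, erad, ← hμ]
  push_cast
  ring

end Quad2

/-- **E-TYPE THEOREM (original frame).**  For a rational binary quadratic `D` with `0 < disc` and a bounded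
open `ℚ`-semialgebraic `U` on which `D > 0`, whose frontier lies on `D = 0`, on genuine rational lines and on
adapted conic walls `D = q²` whose Lagrange transforms are good: `[U, γ√D] ∈ InBaker` (Lagrange map, rule (2),
then `InBaker.of_Eplane`). [KontsevichZagier2001 §1.2 rules (1)–(3); this node] -/
theorem InBaker.of_Equad (D : Quad2) (hdisc : 0 < D.disc) (γ : ℚ) {n m : ℕ} (ℓ : Fin n → Wall)
    (q : Fin m → Wall) (hq : ∀ j, (q j).precomp D.lagM.inv ∈ goodWalls 1 D.eκ D.d11 D.cst)
    (σ : KZ.IntegralRep 2) (hσo : IsOpen σ.domain) (hσb : Bornology.IsBounded σ.domain)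
    (hD : ∀ p ∈ σ.domain, 0 < D.eval (p 0) (p 1))
    (hσi : ∀ p ∈ σ.domain, σ.integrand p = γ * √(D.eval (p 0) (p 1)))
    (hfr : ∀ p ∈ closure σ.domain, p ∉ σ.domain → p ∈ wallLocus (fun p => D.eval (p 0) (p 1)) ℓ q) :
    InBaker (KZ.of σ) := by
  have h11 := D.d11_ne_of_disc_pos hdisc
  have hdet : D.lagM.det ≠ 0 := by rw [D.lagM_det]; exact one_ne_zero
  obtain ⟨τ, hτd, hτi⟩ := exists_ellRep (D.lagM.isSemialgebraic_image σ.isSemialgebraic_domain)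
    (D.lagM.isBounded_image hσb) 1 D.eκ γ D.d11 D.cst
  refine D.lagM.inBaker_to hdet σ τ hτd (fun p hp => ?_) ?_
  · rw [hτi _ (by rw [hτd]; exact mem_image_of_mem _ hp), ellW_eq_erad, ← D.eval_eq_erad h11 hdisc.ne' p, D.lagM_det, hσi p hp]
    simp
  refine InBaker.of_Eplane ⟨one_pos, D.eκ_pos hdisc⟩ γ D.d11 D.cst h11
    (fun i => (ℓ i).precomp D.lagM.inv) (fun j => (q j).precomp D.lagM.inv) hq τ
    (by rw [hτd]; exact D.lagM.isOpen_image hdet hσo) (by rw [hτd]; exact D.lagM.isBounded_image hσb)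
    ?_ hτi ?_
  · rw [hτd]
    rintro _ ⟨p, hp, rfl⟩
    rw [← D.eval_eq_erad h11 hdisc.ne' p]
    exact hD p hp
  · rw [hτd]
    exact wallLocus_transport D.lagM hdet (fun p => (D.eval_eq_erad h11 hdisc.ne' p).symm)
      (fun i p => by rw [Wall.precomp_eval, D.lagM.inv_toFun hdet])
      (fun i hg => Wall.precomp_gen _ (D.lagM.inv_det_ne hdet) hg)
      (fun j p => by rw [Wall.precomp_eval, D.lagM.inv_toFun hdet]) hfr

/-! #### 43.2 The wall-family atoms of an E-type quadric -/

namespace Quadric₃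

variable (K : Quadric₃)

/-- The affine form `B_ℓ = 2Aℓ + B` of the wall `ℓ`, as a `Wall`. -/
def bwall (ℓ : Wall) : Wall := ⟨(K.shiftW ℓ).b0, (K.shiftW ℓ).b1, (K.shiftW ℓ).b2⟩

/-- Auxiliary step `bwall_eval`. [bookkeeping] -/
theorem bwall_eval (ℓ : Wall) (x y : ℝ) : (K.bwall ℓ).eval x y = (K.shiftW ℓ).Bxy x y := rfl

/-- **REDUCTION TO THE GENERIC ATOM.**  To put `[atom, γ√D]` in the Baker sector for an atom of the wall
family `K.wfam ℓ₁ ℓ₂ g` it suffices to treat the GENERIC atom: non-empty, open, bounded, `D > 0` on it,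
`σ i = 0` exactly for the identically vanishing conics of the family, and frontier on the wall locus of `D`
for the seven lines (the four edges, the two `B`-walls, `g`) and the two conic walls `D = B_{ℓᵢ}²`.  Empty and
null atoms and atoms with `√D ≡ 0` are discharged here. [KontsevichZagier2001 §1.2 rule (1); this node] -/
theorem sqrtDescentW_generic (ℓ₁ ℓ₂ g : Wall) (γ : ℚ) (σ : Fin 6 → SignType)
    (r : KZ.IntegralRep 2) (hrd : r.domain = atomFam (K.wfam ℓ₁ ℓ₂ g) σ)
    (hri : EqOn r.integrand (fun v => (γ : ℝ) * √(K.Dxy (v 0) (v 1))) r.domain)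
    (h : IsOpen r.domain → Bornology.IsBounded r.domain →
      (∀ p ∈ r.domain, 0 < K.dq.eval (p 0) (p 1)) →
      (∀ p ∈ r.domain, r.integrand p = (γ : ℝ) * √(K.dq.eval (p 0) (p 1))) →
      (∀ p ∈ closure r.domain, p ∉ r.domain → p ∈ wallLocus (fun p => K.dq.eval (p 0) (p 1))
        ![(⟨0, 1, 0⟩ : Wall), ⟨-1, 1, 0⟩, ⟨0, 0, 1⟩, ⟨-1, 0, 1⟩, K.bwall ℓ₁, K.bwall ℓ₂, g]
        ![K.bwall ℓ₁, K.bwall ℓ₂]) →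
      (∀ i, σ i = 0 → ∀ v : Fin 2 → ℝ, (K.wfam ℓ₁ ℓ₂ g i).pxy (v 0) (v 1) = 0) →
      r.domain.Nonempty → InBaker (KZ.of r)) :
    InBaker (KZ.of r) := by
  classical
  -- degenerate atoms: empty, or inside the zero set of a non-trivial conic of the family
  by_cases hemp : ∃ i, (∀ v : Fin 2 → ℝ, (K.wfam ℓ₁ ℓ₂ g i).pxy (v 0) (v 1) = 0) ∧ σ i ≠ 0
  · obtain ⟨i, hi0, hσ⟩ := hemp
    refine InBaker.of_domain_eq_empty r ?_
    rw [hrd]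
    refine eq_empty_of_forall_notMem fun v hv => hσ ?_
    rw [← hv.2 i, hi0 v, sign_zero]
  by_cases hnull : ∃ i, σ i = 0 ∧ ∃ v : Fin 2 → ℝ, (K.wfam ℓ₁ ℓ₂ g i).pxy (v 0) (v 1) ≠ 0
  · obtain ⟨i, hσ, v, hv⟩ := hnull
    refine InBaker.of_subset_zeroSet r (K.wfam ℓ₁ ℓ₂ g i).pxyP
      ⟨v, by rwa [(K.wfam ℓ₁ ℓ₂ g i).aeval_pxyP]⟩ fun x hx => ?_
    rw [(K.wfam ℓ₁ ℓ₂ g i).aeval_pxyP]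
    rw [hrd] at hx
    exact sign_eq_zero_iff.1 ((hx.2 i).trans hσ)
  replace hnull : ∀ i, σ i = 0 → ∀ v : Fin 2 → ℝ, (K.wfam ℓ₁ ℓ₂ g i).pxy (v 0) (v 1) = 0 :=
    fun i hσ v => by_contra fun hv => hnull ⟨i, hσ, v, hv⟩
  -- `σ 0 ≠ 1`: `√D ≡ 0` on the atom
  by_cases hσ0 : σ 0 ≠ 1
  · refine InBaker.of_mem_relations (KZ.of_mem_relations_of_eqOn_zero r fun v hv => ?_)
    have hv' : v ∈ atomFam (K.wfam ℓ₁ ℓ₂ g) σ := by rw [← hrd]; exact hv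
    rw [hri hv]
    show (γ : ℝ) * √(K.Dxy (v 0) (v 1)) = 0
    rw [K.sqrt_Dxy_eq_zero_of_wsign ℓ₁ ℓ₂ g σ hσ0 hv', mul_zero]
  rw [not_not] at hσ0
  -- the empty atom once more (cheaply), else a witness point
  by_cases hne : r.domain = ∅
  · exact InBaker.of_domain_eq_empty r hne
  obtain ⟨v₀, hv₀⟩ := nonempty_iff_ne_empty.2 hne
  rw [hrd] at hv₀
  obtain ⟨-, -, s2, -, s4, s5⟩ := K.wfam_sign ℓ₁ ℓ₂ g σ hv₀
  -- the generic atom: open, bounded, `D > 0`, frontier on the wall locus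
  have hWI : atomFam (K.wfam ℓ₁ ℓ₂ g) σ ⊆ Icc 0 1 := fun v hv =>
    ⟨fun j => (hv.1 j).1.le, fun j => (hv.1 j).2.le⟩
  have hfr : ∀ z ∈ closure r.domain, z ∉ r.domain → z ∈ wallLocus (fun p => K.dq.eval (p 0) (p 1))
      ![(⟨0, 1, 0⟩ : Wall), ⟨-1, 1, 0⟩, ⟨0, 0, 1⟩, ⟨-1, 0, 1⟩, K.bwall ℓ₁, K.bwall ℓ₂, g]
      ![K.bwall ℓ₁, K.bwall ℓ₂] := by
    rw [hrd]
    intro z hzc hzW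
    rcases frontier_atomFam_generic _ σ hnull hzc hzW with ⟨j, hj⟩ | ⟨i, hsi, hi⟩
    · refine Or.inr (Or.inl ?_)
      have hj2 : j = 0 ∨ j = 1 := by fin_cases j <;> simp
      rcases hj2 with rfl | rfl
      · rcases hj with h | h
        · exact ⟨0, Or.inl one_ne_zero, by simp [Wall.eval, h]⟩
        · exact ⟨1, Or.inl one_ne_zero, by simp [Wall.eval, h]⟩
      · rcases hj with h | h
        · exact ⟨2, Or.inr one_ne_zero, by simp [Wall.eval, h]⟩
        · exact ⟨3, Or.inr one_ne_zero, by simp [Wall.eval, h]⟩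
    · have hi6 : i = 0 ∨ i = 1 ∨ i = 2 ∨ i = 3 ∨ i = 4 ∨ i = 5 := by fin_cases i <;> simp
      rcases hi6 with rfl | rfl | rfl | rfl | rfl | rfl
      · -- `D = 0`
        refine Or.inl ?_
        show K.dq.eval (z 0) (z 1) = 0
        rw [← K.Dxy_eq_dq, show K.Dxy (z 0) (z 1) = K.adapted 0 z from rfl, K.adapted_eq_conic]
        exact hi
      · -- `C_{ℓ₁} = 0`: the conic wall `D = B_{ℓ₁}²`
        have hC : (K.shiftW ℓ₁).Cxy (z 0) (z 1) = 0 := by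
          rw [show (K.shiftW ℓ₁).Cxy (z 0) (z 1) = (K.shiftW ℓ₁).adapted 1 z from rfl,
            (K.shiftW ℓ₁).adapted_eq_conic]; exact hi
        refine Or.inr (Or.inr ⟨0, ?_⟩)
        show K.dq.eval (z 0) (z 1) = ((K.bwall ℓ₁).eval (z 0) (z 1)) ^ 2
        rw [← K.Dxy_eq_dq, K.bwall_eval]
        exact K.Dxy_eq_sq_of_wall ℓ₁ hC
      · -- `B_{ℓ₁} = 0`: a genuine line, or the atom would be empty
        have hB : (K.shiftW ℓ₁).Bxy (z 0) (z 1) = 0 := by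
          rw [show (K.shiftW ℓ₁).Bxy (z 0) (z 1) = (K.shiftW ℓ₁).adapted 3 z from rfl,
            (K.shiftW ℓ₁).adapted_eq_conic]; exact hi
        by_cases hg : (K.bwall ℓ₁).k1 ≠ 0 ∨ (K.bwall ℓ₁).k2 ≠ 0
        · exact Or.inr (Or.inl ⟨4, hg, hB⟩)
        · exfalso
          simp only [not_or, not_not] at hg
          have hconst : ∀ v : Fin 2 → ℝ, (K.shiftW ℓ₁).Bxy (v 0) (v 1) = (K.bwall ℓ₁).k0 := fun v => by
            rw [← K.bwall_eval, Wall.eval, hg.1, hg.2]; push_cast; ring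
          apply hsi
          rw [← s2, hconst v₀, ← hconst z, hB, sign_zero]
      · -- `C_{ℓ₂} = 0`
        have hC : (K.shiftW ℓ₂).Cxy (z 0) (z 1) = 0 := by
          rw [show (K.shiftW ℓ₂).Cxy (z 0) (z 1) = (K.shiftW ℓ₂).adapted 1 z from rfl,
            (K.shiftW ℓ₂).adapted_eq_conic]; exact hi
        refine Or.inr (Or.inr ⟨1, ?_⟩)
        show K.dq.eval (z 0) (z 1) = ((K.bwall ℓ₂).eval (z 0) (z 1)) ^ 2
        rw [← K.Dxy_eq_dq, K.bwall_eval]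
        exact K.Dxy_eq_sq_of_wall ℓ₂ hC
      · -- `B_{ℓ₂} = 0`
        have hB : (K.shiftW ℓ₂).Bxy (z 0) (z 1) = 0 := by
          rw [show (K.shiftW ℓ₂).Bxy (z 0) (z 1) = (K.shiftW ℓ₂).adapted 3 z from rfl,
            (K.shiftW ℓ₂).adapted_eq_conic]; exact hi
        by_cases hg : (K.bwall ℓ₂).k1 ≠ 0 ∨ (K.bwall ℓ₂).k2 ≠ 0
        · exact Or.inr (Or.inl ⟨5, hg, hB⟩)
        · exfalso
          simp only [not_or, not_not] at hg
          have hconst : ∀ v : Fin 2 → ℝ, (K.shiftW ℓ₂).Bxy (v 0) (v 1) = (K.bwall ℓ₂).k0 := fun v => by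
            rw [← K.bwall_eval, Wall.eval, hg.1, hg.2]; push_cast; ring
          apply hsi
          rw [← s4, hconst v₀, ← hconst z, hB, sign_zero]
      · -- `g = 0`
        have hG : g.eval (z 0) (z 1) = 0 := by rw [← g.toConic_pxy]; exact hi
        by_cases hg : g.k1 ≠ 0 ∨ g.k2 ≠ 0
        · exact Or.inr (Or.inl ⟨6, hg, hG⟩)
        · exfalso
          simp only [not_or, not_not] at hg
          have hconst : ∀ v : Fin 2 → ℝ, g.eval (v 0) (v 1) = g.k0 := fun v => by
            rw [Wall.eval, hg.1, hg.2]; push_cast; ring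
          apply hsi
          rw [← s5, hconst v₀, ← hconst z, hG, sign_zero]
  refine h (by rw [hrd]; exact isOpen_atomFam_generic _ σ hnull)
    (by rw [hrd]; exact (Metric.isBounded_Icc (0 : Fin 2 → ℝ) 1).subset hWI) (fun p hp => ?_)
    (fun p hp => ?_) hfr hnull ⟨v₀, by rw [hrd]; exact hv₀⟩
  · rw [hrd] at hp
    rw [← K.Dxy_eq_dq]
    exact sign_eq_one_iff.1 ((K.wfam_sign ℓ₁ ℓ₂ g σ hp).1.trans hσ0)
  · rw [hri hp]
    show (γ : ℝ) * √(K.Dxy (p 0) (p 1)) = _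
    rw [K.Dxy_eq_dq]

/-- **`hW` ON E-TYPE QUADRICS.**  The hypothesis `hW` of `quadricBakerDescent_of_sqrtDescentW` holds for a
quadric `K` whose fibre discriminant `D` has positive-discriminant quadratic part, off the thin strata where
a `B`-wall `2Aℓᵢ + B` is not a good conic wall of `D` in the Lagrange frame:
`[atom, γ√D] ∈ InBaker` for every atom of the wall family `K.wfam ℓ₁ ℓ₂ g` and every sign vector.
[KontsevichZagier2001 §1.2; this node] -/
theorem sqrtDescentW_Etype (hE : 0 < K.dq.disc) (ℓ₁ ℓ₂ g : Wall) (γ : ℚ) (σ : Fin 6 → SignType)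
    (h₁ : (K.bwall ℓ₁).precomp K.dq.lagM.inv ∈ goodWalls 1 K.dq.eκ K.dq.d11 K.dq.cst)
    (h₂ : (K.bwall ℓ₂).precomp K.dq.lagM.inv ∈ goodWalls 1 K.dq.eκ K.dq.d11 K.dq.cst)
    (r : KZ.IntegralRep 2) (hrd : r.domain = atomFam (K.wfam ℓ₁ ℓ₂ g) σ)
    (hri : EqOn r.integrand (fun v => (γ : ℝ) * √(K.Dxy (v 0) (v 1))) r.domain) :
    InBaker (KZ.of r) :=
  K.sqrtDescentW_generic ℓ₁ ℓ₂ g γ σ r hrd hri fun ho hb hD hi hfr _ _ =>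
    InBaker.of_Equad K.dq hE γ _ _ (fun j => by fin_cases j <;> assumption) r ho hb hD hi hfr

end Quadric₃

/-! #### 43.3 The residual of `hW` and of `QuadricBakerDescent` after the E-type assembly -/

/-- **THE RESIDUAL OF `hW`.**  The hypothesis `hW` of `quadricBakerDescent_of_sqrtDescentW` (all quadrics, all walls)
follows from its instances on three strata: (R-H) quadrics whose fibre discriminant `D` has INDEFINITE quadratic part
(`disc < 0`), (R-P) rank `≤ 1` quadratic part (`disc = 0`), and (R-Eθ) E-type quadrics (`0 < disc`) with a wall pair ON
the two thin strata (a transported `B`-wall is not a good conic wall); the rest is `Quadric₃.sqrtDescentW_Etype`.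
[this node] -/
theorem sqrtDescentW_of_residuals
    (hH : ∀ (L : Quadric₃) (ℓ₁ ℓ₂ g : Wall) (γ : ℚ) (σ : Fin 6 → SignType) (r : KZ.IntegralRep 2),
      L.dq.disc < 0 → r.domain = atomFam (L.wfam ℓ₁ ℓ₂ g) σ →
      EqOn r.integrand (fun v => (γ : ℝ) * √(L.Dxy (v 0) (v 1))) r.domain → InBaker (KZ.of r))
    (hP : ∀ (L : Quadric₃) (ℓ₁ ℓ₂ g : Wall) (γ : ℚ) (σ : Fin 6 → SignType) (r : KZ.IntegralRep 2),
      L.dq.disc = 0 → r.domain = atomFam (L.wfam ℓ₁ ℓ₂ g) σ →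
      EqOn r.integrand (fun v => (γ : ℝ) * √(L.Dxy (v 0) (v 1))) r.domain → InBaker (KZ.of r))
    (hθ : ∀ (L : Quadric₃) (ℓ₁ ℓ₂ g : Wall) (γ : ℚ) (σ : Fin 6 → SignType) (r : KZ.IntegralRep 2),
      0 < L.dq.disc →
      ¬((L.bwall ℓ₁).precomp L.dq.lagM.inv ∈ goodWalls 1 L.dq.eκ L.dq.d11 L.dq.cst ∧
          (L.bwall ℓ₂).precomp L.dq.lagM.inv ∈ goodWalls 1 L.dq.eκ L.dq.d11 L.dq.cst) →
      r.domain = atomFam (L.wfam ℓ₁ ℓ₂ g) σ →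
      EqOn r.integrand (fun v => (γ : ℝ) * √(L.Dxy (v 0) (v 1))) r.domain → InBaker (KZ.of r)) :
    ∀ (L : Quadric₃) (ℓ₁ ℓ₂ g : Wall) (γ : ℚ) (σ : Fin 6 → SignType) (r : KZ.IntegralRep 2),
      r.domain = atomFam (L.wfam ℓ₁ ℓ₂ g) σ →
      EqOn r.integrand (fun v => (γ : ℝ) * √(L.Dxy (v 0) (v 1))) r.domain → InBaker (KZ.of r) := by
  intro L ℓ₁ ℓ₂ g γ σ r hrd hri
  rcases lt_trichotomy L.dq.disc 0 with h | h | h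
  · exact hH L ℓ₁ ℓ₂ g γ σ r h hrd hri
  · exact hP L ℓ₁ ℓ₂ g γ σ r h hrd hri
  · by_cases hg : (L.bwall ℓ₁).precomp L.dq.lagM.inv ∈ goodWalls 1 L.dq.eκ L.dq.d11 L.dq.cst ∧
        (L.bwall ℓ₂).precomp L.dq.lagM.inv ∈ goodWalls 1 L.dq.eκ L.dq.d11 L.dq.cst
    · exact L.sqrtDescentW_Etype h ℓ₁ ℓ₂ g γ σ hg.1 hg.2 r hrd hri
    · exact hθ L ℓ₁ ℓ₂ g γ σ r h hg hrd hri

/-- **`QuadricBakerDescent` FROM THE THREE RESIDUALS** (stmt-KontsevichZagierPeriods-27597 ⟸ R-H ∧ R-P ∧ R-Eθ): the landed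
`quadricBakerDescent_of_sqrtDescentW` composed with `sqrtDescentW_of_residuals`. [this node] -/
theorem quadricBakerDescent_of_residuals
    (hH : ∀ (L : Quadric₃) (ℓ₁ ℓ₂ g : Wall) (γ : ℚ) (σ : Fin 6 → SignType) (r : KZ.IntegralRep 2),
      L.dq.disc < 0 → r.domain = atomFam (L.wfam ℓ₁ ℓ₂ g) σ →
      EqOn r.integrand (fun v => (γ : ℝ) * √(L.Dxy (v 0) (v 1))) r.domain → InBaker (KZ.of r))
    (hP : ∀ (L : Quadric₃) (ℓ₁ ℓ₂ g : Wall) (γ : ℚ) (σ : Fin 6 → SignType) (r : KZ.IntegralRep 2),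
      L.dq.disc = 0 → r.domain = atomFam (L.wfam ℓ₁ ℓ₂ g) σ →
      EqOn r.integrand (fun v => (γ : ℝ) * √(L.Dxy (v 0) (v 1))) r.domain → InBaker (KZ.of r))
    (hθ : ∀ (L : Quadric₃) (ℓ₁ ℓ₂ g : Wall) (γ : ℚ) (σ : Fin 6 → SignType) (r : KZ.IntegralRep 2),
      0 < L.dq.disc →
      ¬((L.bwall ℓ₁).precomp L.dq.lagM.inv ∈ goodWalls 1 L.dq.eκ L.dq.d11 L.dq.cst ∧
          (L.bwall ℓ₂).precomp L.dq.lagM.inv ∈ goodWalls 1 L.dq.eκ L.dq.d11 L.dq.cst) →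
      r.domain = atomFam (L.wfam ℓ₁ ℓ₂ g) σ →
      EqOn r.integrand (fun v => (γ : ℝ) * √(L.Dxy (v 0) (v 1))) r.domain → InBaker (KZ.of r)) :
    Summit.KontsevichZagierPeriods.KontsevichZagierPeriods.Theses.RootDecompWalshStrata.QuadricBakerDescent :=
  quadricBakerDescent_of_sqrtDescentW (sqrtDescentW_of_residuals hH hP hθ)

end Summit.KontsevichZagierPeriods.RootDecompWalshStrata.ConicDescent.BallCube

end
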